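import Summits.NavierStokesRegularity.NavierStokesRegularity.Theorems.AxisTwistDoorAveragedConeLiouvilleNUShrinking
import Summits.NavierStokesRegularity.NavierStokesRegularity.Theorems.AxisTwistDoorAveragedConeLiouvilleNUShrinkingLevelsLip
import Summits.NavierStokesRegularity.NavierStokesRegularity.Theorems.AxisTwistDoorAveragedConeLiouvilleNULipDefs
import HarnessLib

/-!
# AxisTwistDoorAveragedConeLiouvilleNUShrinkingLip — T1 piece L33ᴸ: the SHRINKING atom over LIPSCHITZ slices,
# `nuLip_shrinking : Sig.nuLip_shrinking` (text of `pub/ns-inputs/kits/N4-T1-skeleton.lean`, sha16 `118454bf17607d1e`)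

Seat ns-qj-p1 g3 (plan g6 key 13:35:09Z; director KEY-NS #145), `--supports stmt-NavierStokesRegularity-26889 --as
helper`. The Lipschitz-slice twin of the landed axis-free atom `NU.nu_shrinking` (p634023,
`…AveragedConeLiouvilleNUShrinking.lean`): the standing hypotheses `NUStanding` (slices `C¹` for a.e. `t`) are
replaced by `NUStandingLip` of the T1 kit (every slice `L`-Lipschitz for one `L`), the statement being otherwise
the kit text BY NAME (`Sig.nuLip_shrinking` / `NUStandingLip` of the tree's `…AveragedConeLiouvilleNULipDefs`, = kit sha16 `118454bf17607d1e`). Proof =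
`nu_shrinking`'s script with two changes only:
* the measure-theoretic core is the Lipschitz twin `shrinkingLevels_measure_le_of_lipschitz`
  (`…NUShrinkingLevelsLip`, De Giorgi's isoperimetric inequality for Lipschitz slices, ns-in-ser-a g2's p637969);
* the joint a.e.-measurability of the slice gradient `z ↦ D(Φ z.1)(z.2)` no longer comes from everywhere
  differentiability of a.e. slice but from JOINT CONTINUITY on `{t < 0}`: on each sub-slab `]a, c] × B`, `c < 0`,
  the clamped family `t ↦ Φ(min t c)` is globally jointly continuous, so Mathlib's parametric measurability of the
  Fréchet derivative (`measurable_fderiv_with_param`) applies, and the sub-slabs exhaust `]a, t₀[ × B`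
  (`aestronglyMeasurable_fderiv_slice_of_continuousOn`).
The energy estimate `nu_lintegral_fderiv_sq_sublevel_le_shape'` (C¹-free) is used BY NAME.

An INPUT tool (N4/T1 Lipschitz port of the N–U De Giorgi chain toward the typed Literature fact
`NazarovUraltseva2011_positivity_propagation`); no Navier–Stokes statement is touched; item 26889 and the summit
stay OPEN. [cite: NazarovUraltseva2011HarnackDivFree, §3 Lemma 3.3; NazarovUraltseva2012, Lemma 3.3, Remarks 5, 9]
-/

-- the problem directory repeats the summit name (D-0017); core's `dupNamespace` linter fires
set_option linter.dupNamespace false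

noncomputable section

open MeasureTheory Set Function Filter Topology Metric Module
open scoped NNReal ENNReal

namespace Summit.NavierStokesRegularity.NavierStokesRegularity.Theorems.AveragedConeLiouville.NU

open Literature.Analysis.FluidPDE Literature.Analysis.FluidPDE.LeiZhang2011
open Summit.NavierStokesRegularity.NavierStokesRegularity.Theorems.AxisymmetricKatoGlobal.EulerScaling
open Summit.NavierStokesRegularity.NavierStokesRegularity.Theorems.AveragedConeLiouville.NUPositivity

/-! ### Joint measurability of the slice gradient from joint continuity -/

/-- **Joint a.e.-measurability of the slice gradient from joint continuity on `{t < 0}`.** If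
`uncurry Φ` is continuous on `{z | z.1 < 0}` and `t₀ ≤ 0`, then `z ↦ D(Φ z.1)(z.2)` (junk `0` where the slice is
not differentiable) is a.e.-strongly measurable on `]a, t₀[ × B` for every measurable `B`: on `]a, t₀ − (n+1)⁻¹] × B`
it agrees with the derivative family of the clamped, globally continuous `(t, x) ↦ Φ(min t (t₀ − (n+1)⁻¹), x)`,
which is measurable by Mathlib's `measurable_fderiv_with_param`. [folklore] -/
theorem aestronglyMeasurable_fderiv_slice_of_continuousOn {Φ : ℝ → EuclideanSpace ℝ (Fin 3) → ℝ}
    (hcont : ContinuousOn (uncurry Φ) {z : ℝ × EuclideanSpace ℝ (Fin 3) | z.1 < 0}) {a t₀ : ℝ} (ht₀ : t₀ ≤ 0)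
    {B : Set (EuclideanSpace ℝ (Fin 3))} (hB : MeasurableSet B) :
    AEStronglyMeasurable (fun z : ℝ × EuclideanSpace ℝ (Fin 3) => fderiv ℝ (Φ z.1) z.2)
      (volume.restrict (Ioo a t₀ ×ˢ B)) := by
  -- exhaust `]a, t₀[` by `]a, c n[`, `c n = t₀ - (n+1)⁻¹ < 0`
  set c : ℕ → ℝ := fun n => t₀ - ((n : ℝ) + 1)⁻¹ with hc
  have hcneg : ∀ n, c n < 0 := fun n => by
    have : (0 : ℝ) < ((n : ℝ) + 1)⁻¹ := by positivity
    simp only [hc]; linarith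
  have hU : Ioo a t₀ ×ˢ B = ⋃ n : ℕ, Ioo a (c n) ×ˢ B := by
    ext z
    simp only [mem_prod, mem_Ioo, mem_iUnion]
    constructor
    · rintro ⟨⟨h1, h2⟩, h3⟩
      obtain ⟨n, hn⟩ := exists_nat_gt (t₀ - z.1)⁻¹
      have hpos : 0 < t₀ - z.1 := by linarith
      refine ⟨n, ⟨h1, ?_⟩, h3⟩
      have h4 : ((n : ℝ) + 1)⁻¹ < t₀ - z.1 := by
        rw [inv_lt_comm₀ (by positivity) hpos]
        linarith
      simp only [hc]; linarith
    · rintro ⟨n, ⟨h1, h2⟩, h3⟩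
      have : (0 : ℝ) < ((n : ℝ) + 1)⁻¹ := by positivity
      exact ⟨⟨h1, by simp only [hc] at h2; linarith⟩, h3⟩
  rw [hU, aestronglyMeasurable_iUnion_iff]
  intro n
  -- the clamped family is globally continuous
  set Ψ : ℝ → EuclideanSpace ℝ (Fin 3) → ℝ := fun t x => Φ (min t (c n)) x with hΨ
  have hΨc : Continuous (uncurry Ψ) := by
    have h1 : Continuous fun z : ℝ × EuclideanSpace ℝ (Fin 3) => ((min z.1 (c n), z.2) : ℝ × _) :=
      (continuous_fst.min continuous_const).prodMk continuous_snd
    have h2 : ∀ z : ℝ × EuclideanSpace ℝ (Fin 3),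
        ((min z.1 (c n), z.2) : ℝ × EuclideanSpace ℝ (Fin 3)) ∈ {z : ℝ × EuclideanSpace ℝ (Fin 3) | z.1 < 0} :=
      fun z => lt_of_le_of_lt (min_le_right _ _) (hcneg n)
    exact hcont.comp_continuous h1 h2
  have hmeas : Measurable fun z : ℝ × EuclideanSpace ℝ (Fin 3) => fderiv ℝ (Ψ z.1) z.2 :=
    measurable_fderiv_with_param ℝ hΨc
  refine (hmeas.stronglyMeasurable.aestronglyMeasurable).congr ?_
  refine (ae_restrict_iff' (measurableSet_Ioo.prod hB)).2 (Eventually.of_forall fun z hz => ?_)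
  have hz1 : z.1 ≤ c n := (mem_Ioo.1 hz.1).2.le
  have hslice : Ψ z.1 = Φ z.1 := by
    funext x; simp only [hΨ, min_eq_left hz1]
  show fderiv ℝ (Ψ z.1) z.2 = fderiv ℝ (Φ z.1) z.2
  rw [hslice]

/-! ### The atom -/

/-- **Nazarov–Uraltseva 2012, Lemma 3.3 (shrinking levels) over LIPSCHITZ slices — the text
`Sig.nuLip_shrinking` of the T1 kit** (`NUStanding ↦ NUStandingLip`; constants `(λ_lo, θ_lo, θ_hi, μ, δ₁, N) ↦ s`).
Proof: `nu_shrinking`'s script with the Lipschitz core `shrinkingLevels_measure_le_of_lipschitz` and the slice-gradient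
measurability from joint continuity.
[cite: NazarovUraltseva2011HarnackDivFree, §3 Lemma 3.3; NazarovUraltseva2012, Lemma 3.3, Remarks 5, 9] -/
theorem nuLip_shrinking : Sig.nuLip_shrinking := by
  intro lamlo θmin θmax μ δ₁ N hlam hlam2 hθmin hθmm hμ hμ1 hδ₁
  have hθmax : 0 < θmax := hθmin.trans_le hθmm
  obtain ⟨C, hC0, hC⟩ := nu_lintegral_fderiv_sq_sublevel_le_shape' lamlo θmax N hlam hlam2 hθmax
  set V₁ : ℝ := (volume (ball (0 : EuclideanSpace ℝ (Fin 3)) 1)).toReal with hV₁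
  have hV₁pos : 0 < V₁ :=
    ENNReal.toReal_pos (measure_ball_pos _ _ one_pos).ne' measure_ball_lt_top.ne
  set K₀ : ℝ := 4 * (64 * Real.pi / 3) ^ 2 * C / (δ₁ ^ 2 * μ ^ 2 * θmin * V₁ ^ 3) with hK₀
  set s₀ : ℕ := ⌈K₀⌉₊ + 1 with hs₀
  refine ⟨s₀ + 1, ?_⟩
  intro Φ U k R hSt lam ρ θ t₀ κ₀ hlamlo hlam2' hρR hlamρ' hθ1 hθ2 ht₀ hbot hκ₀ hκ₀k hdens
  obtain ⟨-, hR, hΦm, hUvol, hcont, hΦ0, ⟨L, hLip⟩, hdrift, hEC⟩ := hSt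
  have hU : AEStronglyMeasurable (uncurry U)
      (volume.restrict (Ioo (-R ^ 2) 0 ×ˢ ball (0 : EuclideanSpace ℝ (Fin 3)) (2 * R))) :=
    hUvol.restrict
  have hlamρ : lamlo * ρ ≤ 2 * R := by
    have hρ0 : 0 < ρ := by linarith
    nlinarith
  have hρ : 0 < ρ := by linarith
  have hθ : 0 < θ := hθmin.trans_le hθ1
  set a : ℝ := t₀ - θ * ρ ^ 2 with ha
  have hat : a < t₀ := by
    have : 0 < θ * ρ ^ 2 := by positivity
    rw [ha]; linarith
  -- ### the hypotheses of the measure-theoretic core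
  have hΦm' : AEStronglyMeasurable (uncurry Φ)
      (volume.restrict (Ioo a t₀ ×ˢ ball (0 : EuclideanSpace ℝ (Fin 3)) ρ)) :=
    hΦm.aestronglyMeasurable
  have hDm : AEStronglyMeasurable
      (fun z : ℝ × EuclideanSpace ℝ (Fin 3) => fderiv ℝ (Φ z.1) z.2)
      (volume.restrict (Ioo a t₀ ×ˢ ball (0 : EuclideanSpace ℝ (Fin 3)) ρ)) :=
    aestronglyMeasurable_fderiv_slice_of_continuousOn hcont ht₀ measurableSet_ball
  have hδ' : ∀ᵐ t ∂(volume.restrict (Ioo a t₀)),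
      ENNReal.ofReal δ₁ * volume (ball (0 : EuclideanSpace ℝ (Fin 3)) ρ) ≤
        volume (ball (0 : EuclideanSpace ℝ (Fin 3)) ρ ∩ {x | κ₀ ≤ Φ t x}) := by
    filter_upwards [hdens] with t ht
    simpa only [inter_def, mem_setOf_eq] using ht
  have hE' : ∀ m : ℕ, 1 ≤ m →
      ∫⁻ z in (Ioo a t₀ ×ˢ ball (0 : EuclideanSpace ℝ (Fin 3)) ρ) ∩ {z | Φ z.1 z.2 < κ₀ / 2 ^ m},
        ‖fderiv ℝ (Φ z.1) z.2‖ₑ ^ 2 ≤ ENNReal.ofReal (C * (κ₀ / 2 ^ m) ^ 2 * ρ ^ 3) := by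
    intro m hm
    have hl : 0 < κ₀ / 2 ^ m := by positivity
    have h2m : (2 : ℝ) ≤ 2 ^ m := by
      calc (2 : ℝ) = 2 ^ 1 := by norm_num
        _ ≤ 2 ^ m := pow_le_pow_right₀ (by norm_num) hm
    have h2l : 2 * (κ₀ / 2 ^ m) ≤ k := by
      have h1 : 2 * (κ₀ / 2 ^ m) ≤ κ₀ := by
        rw [mul_div_assoc', div_le_iff₀ (by positivity)]
        nlinarith
      linarith
    exact hC Φ U k R hR hΦm hΦ0 hU hdrift hEC ρ θ t₀ (κ₀ / 2 ^ m) hρR hlamρ hθ hθ2 ht₀ hbot hl h2l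
  -- ### the choice of `s`
  have hs₀pos : 0 < s₀ := Nat.succ_pos _
  have hsK : 4 * (64 * Real.pi / 3) ^ 2 * C * ρ ^ 2 /
      (δ₁ ^ 2 * μ ^ 2 * (t₀ - a) * (volume (ball (0 : EuclideanSpace ℝ (Fin 3)) 1)).toReal ^ 3)
        ≤ s₀ := by
    have hta : t₀ - a = θ * ρ ^ 2 := by rw [ha]; ring
    rw [hta, ← hV₁]
    have hnum : 0 ≤ 4 * (64 * Real.pi / 3) ^ 2 * C := by positivity
    calc 4 * (64 * Real.pi / 3) ^ 2 * C * ρ ^ 2 / (δ₁ ^ 2 * μ ^ 2 * (θ * ρ ^ 2) * V₁ ^ 3)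
        = 4 * (64 * Real.pi / 3) ^ 2 * C / (δ₁ ^ 2 * μ ^ 2 * θ * V₁ ^ 3) := by
          field_simp
      _ ≤ K₀ := by
          rw [hK₀]
          exact div_le_div_of_nonneg_left hnum (by positivity) (by gcongr)
      _ ≤ (⌈K₀⌉₊ : ℝ) := Nat.le_ceil _
      _ ≤ (s₀ : ℝ) := by rw [hs₀]; push_cast; linarith
  have hcore := shrinkingLevels_measure_le_of_lipschitz Φ 0 ρ a t₀ κ₀ δ₁ C hρ hat hκ₀ hδ₁ hC0 hΦm' hDm hLip
    hδ' hE' hμ hs₀pos hsK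
  -- ### the level `2^{-(s₀+1)} κ₀` and the set
  have hlev : (2 : ℝ)⁻¹ ^ (s₀ + 1) * κ₀ = κ₀ / 2 ^ (s₀ + 1) := by
    rw [inv_pow]; field_simp
  simp_rw [hlev]
  simpa only [inter_def, mem_setOf_eq] using hcore

/-- Landing check (kit protocol): the atom has exactly the registered type. [folklore] -/
example : Sig.nuLip_shrinking := nuLip_shrinking

end Summit.NavierStokesRegularity.NavierStokesRegularity.Theorems.AveragedConeLiouville.NU

end
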